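import Mathlib
import HarnessLib
import Summits.ResolutionOfSingularities.ResolutionOfSingularities.Theorems.WildQuotientsWildQuotientResolutionS1aModelNodePrincipal
import Summits.ResolutionOfSingularities.ResolutionOfSingularities.Theorems.WildQuotientsWildQuotientResolutionS1aSymSections
import Summits.ResolutionOfSingularities.ResolutionOfSingularities.Theorems.WildQuotientsWildQuotientResolutionS1aKillShift

/-!
# S1a — THE MEMBER OF THE PARALLEL KILL LEAF on a producer chart of the symmetric root: a principal centre `(X₀′ : 2, φ : 1; shift 1, β = s^δ)` with its
chart disjoint from given opens

[OURS · L1 W4.5c · lead-1 g15; R3 brick 5; plan-1 RULING R-F15l (a1_killsIn_two → lines_killsIn_two), R-F15k (b4) member producer ✓`…S1aModelNodePrincipal`;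
lead-1 ANSWER Q-R3 (per component chain type (2,1) with `β = s^d`)] — NOT statements of the manuscript; counted 0; AI-level work, weaker than expert review. Crux
stmt-ResolutionOfSingularities-17941 `CyclicQuotientFourfolds`, line `s1a-logminvertex` v13 (`stub_reachLowerInFX`).

Abstract model `L = k[x_ι][1/h]` of the node of a stable affine chart `W` (`Φ`, `τ = conj Φ σ`), generators `s, X₀, X₁, X₂, x₃` + fixed `Gfix` with the ROWS OF A
SYMMETRIC-ROOT CHART (✓`…S1aSymChartModel`, possibly linearly re-coordinated): `s, X₀` fixed, `X_j ↦ X_j + c_j·s^δX₀`, `x₃ ↦ x₃ + s^δ·T` (tail; `T = X₁R` for the tail `x₁·r`); a COMPONENT `φ = x_{vφ}`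
(a variable) with `τφ = φ + c·s^δX₀` (`c ≠ 0`) and `T = H·φ`, `H` a UNIT (one component per chart).
* `symMember_admissible` ((a′)₁ for `(X₀ : 2, φ : 1)`, `β = s^δ`), `symMember_isolation` (`(X₀, φ) ≤ (aug τ : β)` from `c ≠ 0`, `H` a unit), `symMember_chains` (power
  chains: `u = φ` for `X₀` with unit `c`, `u = x₃` for `φ` with unit `H`);
* ★★★ `exists_isPrincipalCentre_of_symMember` — with degrees, a point off `h = 0` on `V(X₀, φ)`, a GIVEN Veronese degree `d`, and SEPARATING SECTIONS `u_i` on `W`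
  (units on `W ∩ U_i`, `W ∪ ⋃ U_i = M`, model values in `𝒥_{≥1}`): a PRINCIPAL centre `J` of degree `d` with `W` a principal-centre chart, `supp J_d ⊆ W` and
  `supp J_d` DISJOINT from every `U_i` — exactly one member (+ its `hWoff`) of ✓`killsIn_one_of_disjointPrincipalFamily`.
-/

set_option linter.dupNamespace false

noncomputable section

open CategoryTheory Limits AlgebraicGeometry TopologicalSpace Topology Opposite
open Literature.AlgebraicGeometry.Resolution Literature.AlgebraicGeometry.RelativeSpec
open MvPolynomial
open Summit.ResolutionOfSingularities.ResolutionOfSingularities.Theorems.WildQuotientResolution.S1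
open Summit.ResolutionOfSingularities.ResolutionOfSingularities.Theorems.WildQuotientResolution.S1.NodeAtlas
open Summit.ResolutionOfSingularities.ResolutionOfSingularities.Theorems.WildQuotientResolution.S1.ProducerStep
open Summit.ResolutionOfSingularities.ResolutionOfSingularities.Theorems.WildQuotientResolution.S1.CoarseChart
open Summit.ResolutionOfSingularities.ResolutionOfSingularities.Theorems.WildQuotientResolution.S1.GoodCharts
open Summit.ResolutionOfSingularities.ResolutionOfSingularities.Theorems.WildQuotientResolution.S1.NodeTransport
open Summit.ResolutionOfSingularities.ResolutionOfSingularities.Theorems.WildQuotientResolution.S1.NpFrame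
open Summit.ResolutionOfSingularities.ResolutionOfSingularities.Theorems.WildQuotientResolution.S1.KillCert
open Summit.ResolutionOfSingularities.ResolutionOfSingularities.Theorems.WildQuotientResolution.S1.BlowupCharts

/-! ## Pure algebra: (a′)₁, isolation and power chains from the rows -/

namespace Summit.ResolutionOfSingularities.ResolutionOfSingularities.Theorems.WildQuotientResolution.S1.KillCert.Sym

variable {k : Type} [Field k] {L : Type} [CommRing L] [Algebra k L] (τ : L ≃+* L) (s X₀ X₁ X₂ x₃ φ T H : L) (c₁ c₂ c : k) (δ : ℕ) (Gfix : Set L)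
  (hs : τ s = s) (hX₀ : τ X₀ = X₀) (hX₁ : τ X₁ = X₁ + algebraMap k L c₁ * (s ^ δ * X₀)) (hX₂ : τ X₂ = X₂ + algebraMap k L c₂ * (s ^ δ * X₀))
  (hx₃ : τ x₃ = x₃ + s ^ δ * T) (hφ : τ φ = φ + algebraMap k L c * (s ^ δ * X₀)) (hXR : T = H * φ)
  (hfix : ∀ g ∈ Gfix, τ g = g) (hgen : Subring.closure (({s, X₀, X₁, X₂, x₃} : Set L) ∪ Gfix) = ⊤)

include hs hX₀ hX₁ hX₂ hx₃ hφ hXR hfix hgen in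
/-- **(a′)₁ for the member** `(X₀ : 2, φ : 1)`, `β = s^δ`: `y ∈ 𝒥ₙ ⇒ τy − y ∈ (s^δ)·𝒥ₙ₊₁`. [OURS · L1 W4.5c · R3 member] -/
theorem symMember_admissible : ∀ (n : ℕ) (y : L), y ∈ (weightedFiltration (![X₀, φ] : Fin 2 → L) ![2, 1]).ideal n →
    τ y - y ∈ Ideal.span {s ^ δ} * (weightedFiltration (![X₀, φ] : Fin 2 → L) ![2, 1]).ideal (n + 1) := by
  have hJ0 : X₀ ∈ (weightedFiltration (![X₀, φ] : Fin 2 → L) ![2, 1]).ideal 2 := mem_weightedFiltration_ideal (![X₀, φ] : Fin 2 → L) ![2, 1] 0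
  have hJ1 : φ ∈ (weightedFiltration (![X₀, φ] : Fin 2 → L) ![2, 1]).ideal 1 := mem_weightedFiltration_ideal (![X₀, φ] : Fin 2 → L) ![2, 1] 1
  have hJ0' : X₀ ∈ (weightedFiltration (![X₀, φ] : Fin 2 → L) ![2, 1]).ideal 1 := (weightedFiltration _ _).antitone (by norm_num) hJ0
  have hsJ : ∀ {m : ℕ} {y : L}, y ∈ (weightedFiltration (![X₀, φ] : Fin 2 → L) ![2, 1]).ideal m →
      s ^ δ * y ∈ Ideal.span {s ^ δ} * (weightedFiltration (![X₀, φ] : Fin 2 → L) ![2, 1]).ideal m :=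
    fun hy => Ideal.mul_mem_mul (Ideal.mem_span_singleton_self _) hy
  have h0 : ∀ m : ℕ, (0 : L) ∈ Ideal.span {s ^ δ} * (weightedFiltration (![X₀, φ] : Fin 2 → L) ![2, 1]).ideal m := fun m => Ideal.zero_mem _
  refine admissible_shift_of_generators (![X₀, φ] : Fin 2 → L) ![2, 1] τ 1 (s ^ δ) _ hgen ?_ ?_
  · rintro g (hg | hg)
    · simp only [Set.mem_insert_iff, Set.mem_singleton_iff] at hg
      rcases hg with rfl | rfl | rfl | rfl | rfl
      · rw [hs, sub_self]; exact h0 1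
      · rw [hX₀, sub_self]; exact h0 1
      · rw [hX₁, add_sub_cancel_left, show algebraMap k L c₁ * (s ^ δ * X₀) = s ^ δ * (algebraMap k L c₁ * X₀) by ring]
        exact hsJ (Ideal.mul_mem_left _ _ hJ0')
      · rw [hX₂, add_sub_cancel_left, show algebraMap k L c₂ * (s ^ δ * X₀) = s ^ δ * (algebraMap k L c₂ * X₀) by ring]
        exact hsJ (Ideal.mul_mem_left _ _ hJ0')
      · rw [hx₃, add_sub_cancel_left, hXR]; exact hsJ (Ideal.mul_mem_left _ _ hJ1)
    · rw [hfix g hg, sub_self]; exact h0 1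
  · intro i
    fin_cases i
    · change τ X₀ - X₀ ∈ Ideal.span {s ^ δ} * (weightedFiltration (![X₀, φ] : Fin 2 → L) ![2, 1]).ideal (2 + 1)
      rw [hX₀, sub_self]; exact h0 3
    · change τ φ - φ ∈ Ideal.span {s ^ δ} * (weightedFiltration (![X₀, φ] : Fin 2 → L) ![2, 1]).ideal (1 + 1)
      rw [hφ, add_sub_cancel_left, show algebraMap k L c * (s ^ δ * X₀) = s ^ δ * (algebraMap k L c * X₀) by ring]
      exact hsJ (Ideal.mul_mem_left _ _ hJ0)

include hs hX₀ hX₁ hX₂ hx₃ hφ hXR hfix hgen in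
/-- **`τ`-stability** of the member filtration. -/
theorem symMember_map_le : ∀ n : ℕ, ((weightedFiltration (![X₀, φ] : Fin 2 → L) ![2, 1]).ideal n).map (τ : L →+* L) ≤
    (weightedFiltration (![X₀, φ] : Fin 2 → L) ![2, 1]).ideal n :=
  map_le_of_admissible_shift (![X₀, φ] : Fin 2 → L) ![2, 1] τ 1 (s ^ δ) (symMember_admissible τ s X₀ X₁ X₂ x₃ φ T H c₁ c₂ c δ Gfix hs hX₀ hX₁ hX₂ hx₃ hφ hXR hfix hgen)

include hφ hx₃ hXR in
/-- **Isolation** `(X₀, φ) ≤ (aug τ : s^δ)`: `s^δX₀ = c⁻¹(τφ − φ)` and `s^δφ = H⁻¹(τx₃ − x₃)`. [OURS · L1 W4.5c · R3 member] -/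
theorem symMember_isolation (hc : c ≠ 0) (hH : IsUnit H) :
    ∃ N : ℕ, Ideal.span (Set.range (![X₀, φ] : Fin 2 → L)) ^ N ≤ (augmentationIdeal τ).colon (Ideal.span {s ^ δ}) := by
  refine ⟨1, ?_⟩
  rw [pow_one, Ideal.span_le]
  rintro _ ⟨i, rfl⟩
  rw [SetLike.mem_coe, Ideal.mem_colon_span_singleton]
  fin_cases i
  · change X₀ * s ^ δ ∈ augmentationIdeal τ
    have hcu : algebraMap k L c⁻¹ * algebraMap k L c = 1 := by rw [← map_mul, inv_mul_cancel₀ hc, map_one]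
    rw [show X₀ * s ^ δ = algebraMap k L c⁻¹ * (τ φ - φ) by rw [hφ, add_sub_cancel_left, ← mul_assoc, hcu, one_mul, mul_comm]]
    exact Ideal.mul_mem_left _ _ (sub_mem_augmentationIdeal τ φ)
  · change φ * s ^ δ ∈ augmentationIdeal τ
    obtain ⟨Hu, hHu⟩ := hH
    have hx : τ x₃ - x₃ = s ^ δ * (H * φ) := by rw [hx₃, hXR]; ring
    have hx' : φ * s ^ δ = ↑Hu⁻¹ * (τ x₃ - x₃) := by
      rw [hx, ← hHu, mul_left_comm (↑Hu⁻¹ : L), Units.inv_mul_cancel_left, mul_comm]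
    rw [hx']
    exact Ideal.mul_mem_left _ _ (sub_mem_augmentationIdeal τ x₃)

include hφ hx₃ hXR in
/-- **Power chains**: for `X₀` (weight 2): `u = φ`, unit `c`; for `φ` (weight 1): `u = x₃`, unit `H`. [OURS · L1 W4.5c · R3 member] -/
theorem symMember_chains (hc : c ≠ 0) (hH : IsUnit H) : ∀ i : Fin 2, ∃ (mm : ℕ) (u hunit : L), 0 < mm ∧ 1 ≤ mm * (![2, 1] : Fin 2 → ℕ) i ∧ IsUnit hunit ∧
    u ∈ (weightedFiltration (![X₀, φ] : Fin 2 → L) ![2, 1]).ideal (mm * (![2, 1] : Fin 2 → ℕ) i - 1) ∧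
    τ u - u - s ^ δ * hunit * (![X₀, φ] : Fin 2 → L) i ^ mm ∈ Ideal.span {s ^ δ} * (weightedFiltration (![X₀, φ] : Fin 2 → L) ![2, 1]).ideal (mm * (![2, 1] : Fin 2 → ℕ) i + 1) := by
  intro i
  fin_cases i
  · refine ⟨1, φ, algebraMap k L c, one_pos, by norm_num, (IsUnit.mk0 c hc).map _, ?_, ?_⟩
    · exact mem_weightedFiltration_ideal (![X₀, φ] : Fin 2 → L) ![2, 1] 1
    · change τ φ - φ - s ^ δ * algebraMap k L c * X₀ ^ 1 ∈ _
      rw [hφ, show φ + algebraMap k L c * (s ^ δ * X₀) - φ - s ^ δ * algebraMap k L c * X₀ ^ 1 = 0 by ring]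
      exact Ideal.zero_mem _
  · refine ⟨1, x₃, H, one_pos, by norm_num, hH, ?_, ?_⟩
    · change x₃ ∈ (weightedFiltration (![X₀, φ] : Fin 2 → L) ![2, 1]).ideal 0
      exact (weightedFiltration (![X₀, φ] : Fin 2 → L) ![2, 1]).ideal_zero.symm ▸ Submodule.mem_top
    · change τ x₃ - x₃ - s ^ δ * H * φ ^ 1 ∈ _
      rw [hx₃, hXR, show x₃ + s ^ δ * (H * φ) - x₃ - s ^ δ * H * φ ^ 1 = 0 by ring]
      exact Ideal.zero_mem _

end Summit.ResolutionOfSingularities.ResolutionOfSingularities.Theorems.WildQuotientResolution.S1.KillCert.Sym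

/-! ## The member on a chart of a model -/

namespace Summit.ResolutionOfSingularities.ResolutionOfSingularities.Theorems.WildQuotientResolution.S1.GameFrame.GModel

variable {p : ℕ} {X' X₁ : Scheme.{0}} {q : X' ⟶ X₁} {G : Type} [Group G] {ρ : G →* Aut X'} {g₀ : G}

set_option maxHeartbeats 1600000 in
/-- ★★★ **THE MEMBER OF THE PARALLEL KILL LEAF ON A SYMMETRIC-ROOT CHART.** `M` separated, `W` a stable affine chart with node `DW`, free model
`Φ : DW.B ≃ k[x_ι][1/h]` read through `τ` (`hτ`), generators with the rows of a symmetric-root chart and a component variable `φ = x_{vφ}` (`τφ = φ + c·s^δX₀`,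
`c ≠ 0`, `T = Hφ`, `H` a unit), degrees `θ₀, θ₁` of `X₀ = x_{v₀}`, `φ`, a point of `V(x_{v₀}, x_{vφ})` off `h = 0`, a GIVEN Veronese degree `d`, and separating
sections `u_i` for a cover `U_i` of the complement of `W` with model values in `𝒥_{≥1}((X₀, φ); (2,1))`. Then there is a PRINCIPAL centre `J` of degree `d` on `M`
with `W` a principal-centre chart, `supp J_d ⊆ W`, and `supp J_d` disjoint from every `U_i`. [OURS · L1 W4.5c · R3 member; NOT a statement of the manuscript] -/
theorem exists_isPrincipalCentre_of_symMember [Finite G] (hG : ∀ g : G, g ∈ Subgroup.zpowers g₀) (M : GModel p q G ρ g₀)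
    [M.V.IsSeparated] (W : M.act.StableAffineOpens) (DW : NodeData p M.act g₀ W)
    {k : Type} [Field k] {ι : Type} [Finite ι] (hh : MvPolynomial ι k) (Φ : letI := DW.instCommRing; DW.B ≃+* Localization.Away hh)
    (τ : Localization.Away hh ≃+* Localization.Away hh) (hτ : letI := DW.instCommRing; ∀ x, τ x = Φ (DW.σ (Φ.symm x)))
    (v₀ vφ : ι) (hv : v₀ ≠ vφ) (s X₁ X₂ x₃ T H : Localization.Away hh) (c₁ c₂ c : k) (δ : ℕ) (Gfix : Set (Localization.Away hh))
    (hs : τ s = s) (hX₀ : τ (algebraMap (MvPolynomial ι k) (Localization.Away hh) (X v₀)) = algebraMap (MvPolynomial ι k) (Localization.Away hh) (X v₀))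
    (hX₁ : τ X₁ = X₁ + algebraMap k (Localization.Away hh) c₁ * (s ^ δ * algebraMap (MvPolynomial ι k) (Localization.Away hh) (X v₀)))
    (hX₂ : τ X₂ = X₂ + algebraMap k (Localization.Away hh) c₂ * (s ^ δ * algebraMap (MvPolynomial ι k) (Localization.Away hh) (X v₀)))
    (hx₃ : τ x₃ = x₃ + s ^ δ * T)
    (hφ : τ (algebraMap (MvPolynomial ι k) (Localization.Away hh) (X vφ)) = algebraMap (MvPolynomial ι k) (Localization.Away hh) (X vφ) +
      algebraMap k (Localization.Away hh) c * (s ^ δ * algebraMap (MvPolynomial ι k) (Localization.Away hh) (X v₀)))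
    (hc : c ≠ 0) (hXR : T = H * algebraMap (MvPolynomial ι k) (Localization.Away hh) (X vφ)) (hH : IsUnit H)
    (hfix : ∀ g ∈ Gfix, τ g = g)
    (hgen : Subring.closure (({s, algebraMap (MvPolynomial ι k) (Localization.Away hh) (X v₀), X₁, X₂, x₃} : Set (Localization.Away hh)) ∪ Gfix) = ⊤)
    (θ₀ θ₁ : Π j : Fin DW.m, ZMod (DW.r j))
    (hX₀d : letI := DW.instCommRing; letI := DW.instGradedRing; algebraMap (MvPolynomial ι k) (Localization.Away hh) (X v₀) ∈ mapGrading DW.𝒜 Φ θ₀)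
    (hφd : letI := DW.instCommRing; letI := DW.instGradedRing; algebraMap (MvPolynomial ι k) (Localization.Away hh) (X vφ) ∈ mapGrading DW.𝒜 Φ θ₁)
    (g : ι → k) (hg0 : g v₀ = 0) (hgφ : g vφ = 0) (hu : MvPolynomial.eval g hh ≠ 0)
    (d : ℕ) (hd : 0 < d)
    (hver : letI := DW.instCommRing; letI := DW.instGradedRing; letI := mapGradedRing DW.𝒜 Φ;
      VeroneseNormalised (mapGrading DW.𝒜 Φ) (fun i => algebraMap (MvPolynomial ι k) (Localization.Away hh) (X ((![v₀, vφ] : Fin 2 → ι) i))) ![2, 1] d)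
    {κ : Type} (U : κ → M.V.Opens) (hcov : ∀ x : M.V, x ∈ W.1 ∨ ∃ i, x ∈ U i) (u : κ → Γ(M.V, W.1)) (nu : κ → ℕ) (hnu : ∀ i, 0 < nu i)
    (huJ : letI := DW.instCommRing; letI := DW.instGradedRing; ∀ i,
      Φ ((DW.e (u i) : ↥(DW.𝒜 0)) : DW.B) ∈ (weightedFiltration (fun i => algebraMap (MvPolynomial ι k) (Localization.Away hh) (X ((![v₀, vφ] : Fin 2 → ι) i))) ![2, 1]).ideal (nu i))
    (huU : ∀ i, ∀ x ∈ W.1, x ∈ U i → x ∈ M.V.basicOpen (u i)) :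
    ∃ J : ReesFiltration M.V, IsPrincipalCentre p M.act g₀ J d ∧ IsPrincipalCentreChart p M.act g₀ J d W ∧
      (((J.ideal d).support : Set M.V)) ⊆ (W.1 : Set M.V) ∧ ∀ i, Disjoint ((U i : Set M.V)) (((J.ideal d).support : Set M.V)) := by
  classical
  letI := DW.instCommRing
  letI := DW.instGradedRing
  letI := mapGradedRing DW.𝒜 Φ
  set f : Fin 2 → Localization.Away hh := fun i => algebraMap (MvPolynomial ι k) (Localization.Away hh) (X ((![v₀, vφ] : Fin 2 → ι) i)) with hfdef
  have hf : f = (![algebraMap (MvPolynomial ι k) (Localization.Away hh) (X v₀), algebraMap (MvPolynomial ι k) (Localization.Away hh) (X vφ)] : Fin 2 → Localization.Away hh) := by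
    funext i; fin_cases i <;> rfl
  have hτeq : (conj Φ DW.σ : Localization.Away hh ≃+* Localization.Away hh) = τ := RingEquiv.ext fun x => (hτ x).symm
  have hvinj : Function.Injective (![v₀, vφ] : Fin 2 → ι) := by
    intro i j hij
    fin_cases i <;> fin_cases j
    · rfl
    · exact absurd hij hv
    · exact absurd hij.symm hv
    · rfl
  -- the algebra of the member
  have hadm := Sym.symMember_admissible τ s _ X₁ X₂ x₃ _ T H c₁ c₂ c δ Gfix hs hX₀ hX₁ hX₂ hx₃ hφ hXR hfix hgen
  have hiso := Sym.symMember_isolation τ s _ x₃ _ T H c δ hx₃ hφ hXR hc hH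
  have hchain := Sym.symMember_chains τ s _ x₃ _ T H c δ hx₃ hφ hXR hc hH
  rw [← hf] at hadm hiso hchain
  rw [← hτeq] at hadm hiso hchain
  -- closedness from the separating sections
  have hcl : closure (M.V.zeroLocus (U := W.1)
      ((((traceFiltration (mapGrading DW.𝒜 Φ) f ![2, 1]).ideal d).comap
          ((DW.e.trans (zeroRingEquiv DW.𝒜 Φ) : Γ(M.V, W.1) ≃+* ↥(mapGrading DW.𝒜 Φ 0)) : Γ(M.V, W.1) →+* ↥(mapGrading DW.𝒜 Φ 0)) :
        Ideal Γ(M.V, W.1)) : Set Γ(M.V, W.1)) ∩ (W.1 : Set M.V)) ⊆ (W.1 : Set M.V) := by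
    refine closure_zeroLocus_inter_subset_of_cover W.1 U hcov _ u (fun i => ⟨d, hd, ?_⟩) huU
    change (DW.e.trans (zeroRingEquiv DW.𝒜 Φ)) (u i ^ d) ∈ (traceFiltration (mapGrading DW.𝒜 Φ) f ![2, 1]).ideal d
    rw [mem_traceFiltration_iff, map_pow, SetLike.GradeZero.coe_pow]
    change (Φ ((DW.e (u i) : ↥(DW.𝒜 0)) : DW.B)) ^ d ∈ _
    have h := Ideal.pow_mem_pow (huJ i) d
    have hle := Veronese.idealFiltration_pow_le (weightedFiltration f ![2, 1]) (nu i) d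
    exact (weightedFiltration f ![2, 1]).antitone (Nat.le_mul_of_pos_left d (hnu i)) (hle h)
  obtain ⟨J, hJ, hJW, hJsupp, -⟩ := exists_isPrincipalCentre_of_modelNodePowerChains hG M W DW hh Φ two_pos (![v₀, vφ] : Fin 2 → ι) hvinj ![θ₀, θ₁] ![2, 1]
    (fun i => by fin_cases i <;> norm_num) (fun i => by fin_cases i <;> assumption) g (fun i => by fin_cases i <;> assumption) hu d hd hver (s ^ δ) 1
    hadm hiso hchain hcl
  refine ⟨J, hJ, hJW, hJsupp.trans hcl, fun i => ?_⟩
  refine Disjoint.mono_right hJsupp (disjoint_closure_zeroLocus_of_section W.1 (U i) _ (u i) hd ?_ (huU i))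
  change (DW.e.trans (zeroRingEquiv DW.𝒜 Φ)) (u i ^ d) ∈ (traceFiltration (mapGrading DW.𝒜 Φ) f ![2, 1]).ideal d
  rw [mem_traceFiltration_iff, map_pow, SetLike.GradeZero.coe_pow]
  change (Φ ((DW.e (u i) : ↥(DW.𝒜 0)) : DW.B)) ^ d ∈ _
  have h := Ideal.pow_mem_pow (huJ i) d
  have hle := Veronese.idealFiltration_pow_le (weightedFiltration f ![2, 1]) (nu i) d
  exact (weightedFiltration f ![2, 1]).antitone (Nat.le_mul_of_pos_left d (hnu i)) (hle h)

end Summit.ResolutionOfSingularities.ResolutionOfSingularities.Theorems.WildQuotientResolution.S1.GameFrame.GModel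

end
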